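import Literature.Computability.Complexity.PRelHierarchy
import HarnessLib

/-!
# Replaying an oracle algorithm against recorded answer slots

Topic `Literature/Computability/QuantumComplexity`; second file of the discharge of the named fact
`uniformOracleCoinSimulation` (`CoinFamilyKernel.lean`; Bernstein–Vazirani 1997, Thm. 8.3 with
§8.3). The simulating circuit of an oracle algorithm `M` (transcript model of `Oracle.lean`: a step
function `(input, answers so far) ↦ query | output`) proceeds in rounds `t = 0, 1, …, R - 1`; in
round `t` a garbage-free classical block **replays `M` from the start**, answering the query of
round `s` by the bit found in the *answer slot* `(s, ℓ)`, `ℓ` the length of that query, of a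
register of slots written by the oracle gates of the earlier rounds (a slot not yet written reads
`0`); the block writes the whole list of (padded) queries, the oracle gates of round `t` read the
query of round `t` — one gate per admissible length `ℓ ≤ Q`, reading its first `ℓ` bits — and XOR
the oracle's answers into the slots `(t, ℓ)`. This file is the bookkeeping of that replay, at the
level of lists (no circuits, no machines):

* `OSim.asσ M x σ s` — the answers used in the first `s` rounds of the replay against the slot
  function `σ : ℕ → ℕ → Bool`; `OSim.qryσ` (the query of round `s`), `OSim.padTo Q` (padding /
  clipping to length `Q`), `OSim.fieldsσ` (the `R` padded queries), `OSim.outσ` (the first output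
  within `R` rounds), `OSim.wordσ = fieldsσ ++ outσ` (what the block writes);
* `OSim.sigmaSeq M x A Q t` — **the slots after `t` rounds** of the circuit: round `t` sets slot
  `(t, ℓ)`, `ℓ ≤ Q`, to `[first ℓ bits of the padded query of round t ∈ A]`;
* the comparison with the genuine run of `M` with the oracle of `A` (`PRelSigma.trans`,
  `PRelSigma.answerBits` of `PRelHierarchy.lean`): if the slots `(s, |yₛ|)` of the genuine queries
  `yₛ`, `s < k`, hold the genuine answer bits then the replay follows the genuine run for `k` rounds
  (`asσ_eq_answerBits`, "guessed answers drive the run"); the slots written by the circuit have this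
  property (`sigmaSeq_genuine`), whence **`OSim.outσ_sigmaSeq`**: after `R > m` rounds the replay
  outputs the genuine output, and `OSim.qryσ_sigmaSeq`: in round `t < m` the block presents the
  genuine query `yₜ` — so that the gate of length `|yₜ|` asks the oracle exactly `yₜ`
  (`take_length_padTo`);
* `OSim.exists_runShape` — the run data (number of query rounds `m < R`, output, short queries)
  extracted from the clauses of `FPRel`/`PRel` (`PRelSigma.run_eq_some_iff`).

## References

* E. Bernstein, U. Vazirani, *Quantum complexity theory*, SIAM J. Comput. 26 (1997), Thm. 8.3 and
  §8.3 (oracle machines; the answer bit of a query supplied in state `|0⟩` "just as in a classical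
  oracle machine") [BernsteinVazirani1997SICOMP].
* S. Arora, B. Barak, *Computational Complexity: A Modern Approach*, CUP 2009, §3.4, Def. 3.4 (the
  configuration of an oracle machine after `i` answers is determined by the input and those
  answers) [AroraBarak2009].
-/

namespace Literature.Computability.QuantumComplexity

namespace OSim

open Complexity Complexity.PRelSigma

variable {β : Type} (M : OracleAlg β) (x : List Bool)

/-! ### The replay against a slot function -/

/-- The answer bits used in the first `s` rounds of the replay of `M` on `x` against the slot
function `σ` (round, query length ↦ bit): the answer to the query `y` of round `s` is read in slot
`(s, |y|)`. [cite: AroraBarak2009, §3.4 Def. 3.4] -/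
def asσ (σ : ℕ → ℕ → Bool) : ℕ → List Bool
  | 0 => []
  | s + 1 => asσ σ s ++ [σ s (qryOf M x (bitsTrans (asσ σ s))).length]

/-- The query of round `s` of the replay (junk `[]` if `M` outputs at that round). [folklore] -/
def qryσ (σ : ℕ → ℕ → Bool) (s : ℕ) : List Bool :=
  qryOf M x (bitsTrans (asσ M x σ s))

/-- One more round of replayed answers. [folklore] -/
theorem asσ_succ (σ : ℕ → ℕ → Bool) (s : ℕ) :
    asσ M x σ (s + 1) = asσ M x σ s ++ [σ s (qryσ M x σ s).length] := rfl

/-- `asσ` at `0`. [folklore] -/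
@[simp] theorem asσ_zero (σ : ℕ → ℕ → Bool) : asσ M x σ 0 = [] := rfl

/-- There are `s` replayed answers after `s` rounds. [folklore] -/
@[simp] theorem length_asσ (σ : ℕ → ℕ → Bool) : ∀ s, (asσ M x σ s).length = s
  | 0 => rfl
  | s + 1 => by rw [asσ_succ, List.length_append, length_asσ σ s]; rfl

/-- Padding with zeros / clipping to length exactly `Q`. [folklore] -/
def padTo (Q : ℕ) (y : List Bool) : List Bool := (y ++ List.replicate Q false).take Q

/-- `padTo Q` has length `Q`. [folklore] -/
@[simp] theorem length_padTo (Q : ℕ) (y : List Bool) : (padTo Q y).length = Q := by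
  simp [padTo]

/-- The first `|y|` bits of the padding of a short `y` are `y`. [folklore] -/
theorem take_length_padTo {Q : ℕ} {y : List Bool} (hy : y.length ≤ Q) : (padTo Q y).take y.length = y := by
  rw [padTo, List.take_take, min_eq_left hy, List.take_left']
  rfl

/-- Bits of the padding inside `y`. [folklore] -/
theorem getD_padTo_of_lt {Q : ℕ} {y : List Bool} (hy : y.length ≤ Q) {i : ℕ} (hi : i < y.length) :
    (padTo Q y).getD i false = y.getD i false := by
  rw [padTo, List.getD_eq_getElem?_getD, List.getElem?_take, if_pos (lt_of_lt_of_le hi hy),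
    List.getElem?_append_left hi, ← List.getD_eq_getElem?_getD]

/-- The `R` padded queries of the replay, concatenated (`R·Q` bits). [folklore] -/
def fieldsσ (σ : ℕ → ℕ → Bool) (R Q : ℕ) : List Bool :=
  (List.range R).flatMap fun s => padTo Q (qryσ M x σ s)

/-- The fields have `R·Q` bits. [folklore] -/
@[simp] theorem length_fieldsσ (σ : ℕ → ℕ → Bool) (R Q : ℕ) : (fieldsσ M x σ R Q).length = R * Q := by
  unfold fieldsσ
  induction R with
  | zero => simp
  | succ R ih => rw [List.range_succ, List.flatMap_append, List.length_append, ih]; simp [Nat.succ_mul]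

/-- **Bit `s·Q + i` of the fields is bit `i` of the padded query of round `s`.** [folklore] -/
theorem getD_fieldsσ (σ : ℕ → ℕ → Bool) {R Q s i : ℕ} (hs : s < R) (hi : i < Q) :
    (fieldsσ M x σ R Q).getD (s * Q + i) false = (padTo Q (qryσ M x σ s)).getD i false := by
  unfold fieldsσ
  induction R with
  | zero => exact absurd hs (Nat.not_lt_zero _)
  | succ R ih =>
    rw [List.range_succ, List.flatMap_append, List.flatMap_singleton]
    have hlen : ((List.range R).flatMap fun s => padTo Q (qryσ M x σ s)).length = R * Q := length_fieldsσ M x σ R Q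
    rcases Nat.lt_succ_iff_lt_or_eq.1 hs with h | rfl
    · rw [List.getD_append _ _ _ _ (by rw [hlen]; nlinarith), ih h]
    · rw [List.getD_append_right _ _ _ _ (by rw [hlen]; exact Nat.le_add_right _ _), hlen, Nat.add_sub_cancel_left]

/-- Scan the rounds `s, s+1, …, s+k-1` of the replay for the first output. [folklore] -/
def firstOut (σ : ℕ → ℕ → Bool) : ℕ → ℕ → Option β
  | _, 0 => none
  | s, k + 1 =>
    match M.step x (bitsTrans (asσ M x σ s)) with
    | Sum.inr b => some b
    | Sum.inl _ => firstOut σ (s + 1) k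

/-- The output of the replay within `R` rounds (`none` if there is none). [folklore] -/
def outσ (σ : ℕ → ℕ → Bool) (R : ℕ) : Option β :=
  firstOut M x σ 0 R

end OSim

namespace OSim

open Complexity Complexity.PRelSigma

variable (M : OracleAlg (List Bool)) (x : List Bool)

/-- **The word written by the block**: the `R` padded queries, then the output (nothing if there is
no output within `R` rounds). [cite: BernsteinVazirani1997SICOMP, Thm. 8.3 (proof)] -/
def wordσ (σ : ℕ → ℕ → Bool) (R Q : ℕ) : List Bool :=
  fieldsσ M x σ R Q ++ (outσ M x σ R).getD []

/-- Bits of the word inside the fields. [folklore] -/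
theorem getD_wordσ_field (σ : ℕ → ℕ → Bool) {R Q s i : ℕ} (hs : s < R) (hi : i < Q) :
    (wordσ M x σ R Q).getD (s * Q + i) false = (padTo Q (qryσ M x σ s)).getD i false := by
  rw [wordσ, List.getD_append _ _ _ _ (by rw [length_fieldsσ]; nlinarith), getD_fieldsσ M x σ hs hi]

/-- Bits of the word inside the output. [folklore] -/
theorem getD_wordσ_out (σ : ℕ → ℕ → Bool) (R Q j : ℕ) :
    (wordσ M x σ R Q).getD (R * Q + j) false = ((outσ M x σ R).getD []).getD j false := by
  rw [wordσ, List.getD_append_right _ _ _ _ (by rw [length_fieldsσ]; exact Nat.le_add_right _ _), length_fieldsσ,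
    Nat.add_sub_cancel_left]

/-- The length of the word. [folklore] -/
theorem length_wordσ (σ : ℕ → ℕ → Bool) (R Q : ℕ) :
    (wordσ M x σ R Q).length = R * Q + ((outσ M x σ R).getD []).length := by
  rw [wordσ, List.length_append, length_fieldsσ]

end OSim

namespace OSim

open Complexity Complexity.PRelSigma

variable {β : Type} (M : OracleAlg β) (x : List Bool) (A : Language Bool)

/-! ### The slots written by the circuit -/

/-- **The answer slots after `t` rounds.** Initially all slots read `0`; round `t` sets slot
`(t, ℓ)`, `ℓ ≤ Q`, to the oracle's answer on the first `ℓ` bits of the padded query of round `t`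
of the replay against the current slots (for `ℓ` the true length of that query this is the answer
to the query itself; the other slots of the round hold answers to clipped or padded strings and are
never read). [cite: BernsteinVazirani1997SICOMP, Thm. 8.3 (proof) with §8.3] -/
noncomputable def sigmaSeq (Q : ℕ) : ℕ → ℕ → ℕ → Bool
  | 0 => fun _ _ => false
  | t + 1 => fun s ℓ =>
    if s = t ∧ ℓ ≤ Q then A.boolIndicator ((padTo Q (qryσ M x (sigmaSeq Q t) t)).take ℓ)
    else sigmaSeq Q t s ℓ

variable {M x A}

/-- Slots of rounds not yet played read `0`. [folklore] -/
theorem sigmaSeq_of_le {Q : ℕ} : ∀ {t s : ℕ} (_ : t ≤ s) (ℓ : ℕ), sigmaSeq M x A Q t s ℓ = false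
  | 0, _, _, _ => rfl
  | t + 1, s, hts, ℓ => by
    simp only [sigmaSeq]
    rw [if_neg (fun h => by omega), sigmaSeq_of_le (by omega)]

/-- Slots beyond the admissible length are never written. [folklore] -/
theorem sigmaSeq_of_lt_len {Q : ℕ} : ∀ (t s : ℕ) {ℓ : ℕ} (_ : Q < ℓ), sigmaSeq M x A Q t s ℓ = false
  | 0, _, _, _ => rfl
  | t + 1, s, ℓ, hℓ => by
    simp only [sigmaSeq]
    rw [if_neg (fun h => by omega), sigmaSeq_of_lt_len t s hℓ]

/-- Slots of earlier rounds are not rewritten. [folklore] -/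
theorem sigmaSeq_stable {Q : ℕ} : ∀ {t t' : ℕ} (_ : t ≤ t') {s : ℕ} (_ : s < t) (ℓ : ℕ),
    sigmaSeq M x A Q t' s ℓ = sigmaSeq M x A Q t s ℓ
  | t, 0, h, s, hs, ℓ => by omega
  | t, t' + 1, h, s, hs, ℓ => by
    rcases Nat.eq_or_lt_of_le h with rfl | h'
    · rfl
    · simp only [sigmaSeq]
      rw [if_neg (fun hh => by omega), sigmaSeq_stable (Nat.lt_succ_iff.1 h') hs ℓ]

/-- The slot written in round `t`. [folklore] -/
theorem sigmaSeq_succ_self {Q t ℓ : ℕ} (hℓ : ℓ ≤ Q) :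
    sigmaSeq M x A Q (t + 1) t ℓ = A.boolIndicator ((padTo Q (qryσ M x (sigmaSeq M x A Q t) t)).take ℓ) := by
  simp only [sigmaSeq]
  rw [if_pos ⟨trivial, hℓ⟩]

/-- The replay depends only on the slots of the rounds already replayed. [folklore] -/
theorem asσ_congr {σ σ' : ℕ → ℕ → Bool} : ∀ {k : ℕ} (_ : ∀ s < k, ∀ ℓ, σ s ℓ = σ' s ℓ) (s : ℕ), s ≤ k →
    asσ M x σ s = asσ M x σ' s
  | _, _, 0, _ => rfl
  | k, h, s + 1, hs => by
    rw [asσ_succ, asσ_succ, qryσ, qryσ, asσ_congr h s (Nat.le_of_succ_le hs), h s hs]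

/-! ### Comparison with the genuine run -/

section Genuine

variable (M x A)

/-- The query of round `s` of the genuine run of `M` on `x` with the oracle of `A`. [folklore] -/
noncomputable def gq (s : ℕ) : List Bool := qryOf M x (trans M (Oracle.ofLanguage A) x s)

variable {M x A}

/-- **Guessed answers drive the run**: if the slots `(s, |yₛ|)` of the genuine queries `yₛ`, `s < k`,
hold the genuine answer bits, the first `k` rounds of the replay use exactly the genuine answers.
[cite: AroraBarak2009, §3.4 Def. 3.4] -/
theorem asσ_eq_answerBits {σ : ℕ → ℕ → Bool} {k : ℕ}
    (h : ∀ s < k, σ s (gq M x A s).length = A.boolIndicator (gq M x A s)) :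
    ∀ s ≤ k, asσ M x σ s = answerBits M A x s
  | 0, _ => by simp [answerBits]
  | s + 1, hs => by
    have ih := asσ_eq_answerBits h s (Nat.le_of_succ_le hs)
    rw [asσ_succ, qryσ, ih, answerBits_succ, ← trans_eq_bitsTrans_answerBits]
    exact congrArg _ (congrArg (fun b => [b]) (h s hs))

/-- Under the same hypothesis the replay presents the genuine queries for `k + 1` rounds.
[cite: AroraBarak2009, §3.4 Def. 3.4] -/
theorem qryσ_eq_gq {σ : ℕ → ℕ → Bool} {k : ℕ}
    (h : ∀ s < k, σ s (gq M x A s).length = A.boolIndicator (gq M x A s)) {s : ℕ} (hs : s ≤ k) :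
    qryσ M x σ s = gq M x A s := by
  rw [qryσ, asσ_eq_answerBits h s hs, ← trans_eq_bitsTrans_answerBits]; rfl

/-- **The slots written by the circuit hold the genuine answers** at the genuine query lengths, for
every round already played in which the genuine run asks a short query. [cite: BernsteinVazirani1997SICOMP, Thm. 8.3 (proof) with §8.3] -/
theorem sigmaSeq_genuine {Q m : ℕ} (hQ : ∀ s < m, (gq M x A s).length ≤ Q) :
    ∀ (t s : ℕ), s < t → s < m → sigmaSeq M x A Q t s (gq M x A s).length = A.boolIndicator (gq M x A s)
  | 0, _, hs, _ => absurd hs (Nat.not_lt_zero _)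
  | t + 1, s, hst, hsm => by
    rcases Nat.lt_succ_iff_lt_or_eq.1 hst with hst' | rfl
    · rw [sigmaSeq_stable (Nat.le_succ t) hst']
      exact sigmaSeq_genuine hQ t s hst' hsm
    · rw [sigmaSeq_succ_self (hQ s hsm), qryσ_eq_gq (k := s) (fun s' hs' => sigmaSeq_genuine hQ s s' hs' (by omega)) le_rfl,
        take_length_padTo (hQ s hsm)]

/-- **In round `t < m` the block presents the genuine query.** [cite: BernsteinVazirani1997SICOMP, Thm. 8.3 (proof) with §8.3] -/
theorem qryσ_sigmaSeq {Q m t : ℕ} (hQ : ∀ s < m, (gq M x A s).length ≤ Q) (ht : t ≤ m) :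
    qryσ M x (sigmaSeq M x A Q t) t = gq M x A t :=
  qryσ_eq_gq (k := t) (fun s hs => sigmaSeq_genuine hQ t s hs (by omega)) le_rfl

/-- The shape of a genuine run with `m` query rounds and output `b`. [folklore] -/
structure RunShape (M : OracleAlg β) (A : Language Bool) (x : List Bool) (m : ℕ) (b : β) : Prop where
  /-- the first `m` steps are queries -/
  query : ∀ i < m, ∃ y, M.step x (trans M (Oracle.ofLanguage A) x i) = Sum.inl y
  /-- step `m` outputs `b` -/
  output : M.step x (trans M (Oracle.ofLanguage A) x m) = Sum.inr b

/-- Scanning from round `s ≤ m` with enough fuel finds the genuine output, provided the replay follows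
the genuine run up to round `m`. [folklore] -/
theorem firstOut_eq {σ : ℕ → ℕ → Bool} {m : ℕ} {b : β} (hrun : RunShape M A x m b)
    (has : ∀ s ≤ m, asσ M x σ s = answerBits M A x s) :
    ∀ (k s : ℕ), s ≤ m → m < s + k → firstOut M x σ s k = some b
  | 0, s, hs, hk => by omega
  | k + 1, s, hs, hk => by
    rw [firstOut, has s hs, ← trans_eq_bitsTrans_answerBits]
    rcases Nat.eq_or_lt_of_le hs with rfl | hlt
    · rw [hrun.output]
    · obtain ⟨y, hy⟩ := hrun.query s hlt
      rw [hy]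
      exact firstOut_eq hrun has k (s + 1) hlt (by omega)

/-- **After `R > m` rounds the replay against the circuit's slots outputs the genuine output.**
[cite: BernsteinVazirani1997SICOMP, Thm. 8.3 (proof) with §8.3] -/
theorem outσ_sigmaSeq {Q m R : ℕ} {b : β} (hrun : RunShape M A x m b) (hQ : ∀ s < m, (gq M x A s).length ≤ Q)
    (hmR : m < R) {t : ℕ} (hmt : m ≤ t) : outσ M x (sigmaSeq M x A Q t) R = some b :=
  firstOut_eq hrun (asσ_eq_answerBits fun s hs => sigmaSeq_genuine hQ t s (by omega) hs) R 0 (Nat.zero_le _) (by omega)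

/-- **Run data from the `FPRel`/`PRel` clauses**: an output within `R` rounds with all recorded
queries of length `≤ Q` gives a run shape with `m < R` query rounds whose genuine queries are short.
[cite: AroraBarak2009, §3.4 Def. 3.4] -/
theorem exists_runShape {R Q : ℕ} {b : β} (hrun : M.run (Oracle.ofLanguage A) R x = some b)
    (hq : ∀ y ∈ M.queries (Oracle.ofLanguage A) R x, y.length ≤ Q) :
    ∃ m, m < R ∧ RunShape M A x m b ∧ ∀ s < m, (gq M x A s).length ≤ Q := by
  obtain ⟨m, hmR, hqs, hout⟩ := (run_eq_some_iff M _ R x b).1 hrun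
  exact ⟨m, hmR, ⟨hqs, hout⟩, fun s hs => hq _ (mem_queries_of_trans M _ R x s (by omega) fun i hi => hqs i (by omega))⟩

end Genuine

end OSim

end Literature.Computability.QuantumComplexity
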